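import Mathlib
import Summits.NavierStokesRegularity.NavierStokesRegularity.Theorems.OrthantWakeForwardSourceSmoothingTools
import HarnessLib

/-!
# `OrthantWake.ForwardSourceSmoothing` — a subcritical envelope on the FORWARD-SOURCE modes alone
already gives a global regular viscous solution (item stmt-NavierStokesRegularity-26374; shared crux
of routes OrthantWake rev 3 and SubcriticalEnvelope rev 5)

**Statement (verbatim route decl).** For `ε₀, η > 0`, a table `α ∈ E₂(R)`, a set of modes `S`
containing every forward source (`i ∉ S ⇒ α i j l (0,0,1) = 0`), a datum `X₀` and `ν > 0`: if on
every horizon `[0,T]` the `S`-mode partial tail energies of all regular `ν`-viscous solutions on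
sub-windows `[0,s]` obey `Σ_{k=n}^{N} Σ_{i∈S} ½X_{i,k}(t)² ≤ C(T)(1+ε₀)^{-(1+η)n}`, then a GLOBAL
regular solution of the `ν`-viscous lattice exists (`ViscousGlobal ε₀ ν α X₀ X`).

PROOF (slaving of the non-source modes by a finite bootstrap at FIXED `ν`; no sign condition).
Write `λ = 1+ε₀`, `e_k = Σ_i ½X_{i,k}²` (ALL modes of shell `k`), `Π_k = botSum ε₀ α X k` (the bond
flux `k → k+1`).
Tools (file `OrthantWakeForwardSourceSmoothingTools.lean`):
* SHELL ENERGY IDENTITY (`forwardSmoothing_hasDerivWithinAt_shellEnergy`): by the cancellation (4.3)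
  the in-shell and rotor terms drop out of the energy of a whole shell,
  `e_k' = Π_{k-1} − Π_k − 2νλ^{2k} e_k` (Tao's telescoping `Σ_i quadTerm_{i,k} X_{i,k} = A(k) + B(k-1)`,
  `B(k) = −A(k)`).
* FLUX BOUND (`forwardSmoothing_abs_botSum_le`): every term of `Π_k` carries a coefficient
  `α_{i₁i₂i₃,(0,0,1)}` which VANISHES unless its first input `i₁` is a source, `i₁ ∈ S`; hence
  `|Π_k| ≤ 64 λ^{5k/2} · A · B · B'` from `|X_{i,k}| ≤ A (i ∈ S)`, `|X_{i,k}| ≤ B`, `|X_{i,k+1}| ≤ B'`.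
* LINEAR DECAY (`forwardSmoothing_le_of_linearDecay`): `f' ≤ −c f + F`, `f(0) ≤ 0`, `c > 0` give
  `f ≤ F/c` (Grönwall with negative rate).
* ONE PASS (`forwardSmoothing_pass`): if `Σ_{i∈S}½X_{i,k}² ≤ Cλ^{-(1+η)k}` (`η ≤ 1`) and
  `e_k ≤ Kλ^{-ak}` (`0 ≤ a ≤ 1`) for all shells and times, then `|Π_{k-1}|, |Π_k| ≤ 128√(2C)K λ^{(2−η/2−a)k}`
  and the decay lemma at rate `c = 2νλ^{2k}` gives `e_k ≤ (128√(2C)K/ν) λ^{-(a+η/2)k}` for `k ≥ 1`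
  (`e_0 ≤ E₀` by the energy inequality): the all-mode exponent GAINS `η/2` per pass.
* ITERATION (`forwardSourceSmoothing_proof`): start from `a = 0` (`e_k ≤ E₀`, `orthantBreak_energy_le`),
  run `J = ⌊2/η₀⌋ + 1` passes with `η₀ = min η 1` to reach the exponent `a_J = Jη₀/2 > 1`, sum the
  geometric series over `k ∈ [n, N]`, and feed the resulting ALL-MODE envelope (exponent `1+η'`,
  `η' = a_J − 1 > 0`, constant depending on `C(T), ν, E₀, ε₀, η` only) to the landed engine
  `exists_viscousGlobal_of_subcriticalEnvelope_of_inTableClass` (p593260 lineage).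

HONEST FRAMING: statements about Tao-type MODEL lattice ODEs (routes OrthantWake /
SubcriticalEnvelope, rung TL-M2Break); this is the smoothing half only — the forward-source ratchet
/ envelope (the content) is NOT proved here; nothing bears on Navier–Stokes regularity and no
summit is proved.
-/

noncomputable section

-- the sub-problem namespace `NavierStokesRegularity.NavierStokesRegularity` is the tree's layout (D-0017)
set_option linter.dupNamespace false

namespace Summit.NavierStokesRegularity.NavierStokesRegularity.Theorems

open Set Filter
open scoped Topology
open Literature.Analysis.FluidPDE.TaoCascade

/-! ## §3 The item -/

/-- **Item stmt-NavierStokesRegularity-26374** (`OrthantWake.ForwardSourceSmoothing`): at fixed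
`ν > 0`, a subcritical envelope on the forward-source modes of the regular `ν`-viscous solutions
(uniform over sub-windows of each horizon) yields a GLOBAL regular solution of the `ν`-viscous
lattice. Finite bootstrap of `forwardSmoothing_pass` (`⌊2/η₀⌋ + 1` passes, `η₀ = min η 1`) from the
energy bound to an all-mode envelope with exponent `> 1`, then the landed smoothing engine
`exists_viscousGlobal_of_subcriticalEnvelope_of_inTableClass`. MODEL lattice statement; no
Navier–Stokes statement is proved. [this file] -/
theorem forwardSourceSmoothing_proof :
    Summit.NavierStokesRegularity.NavierStokesRegularity.Theses.OrthantWake.ForwardSourceSmoothing := by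
  unfold Summit.NavierStokesRegularity.NavierStokesRegularity.Theses.OrthantWake.ForwardSourceSmoothing
  intro ε₀ η R hε₀ hη α hα S hS X₀ ν hν henvS
  have h0 : (0 : ℝ) < 1 + ε₀ := by linarith
  have h1 : (1 : ℝ) < 1 + ε₀ := by linarith
  have hc : IsCancellingCoeff α := hα.2.1
  have hα1 : ∀ i₁ i₂ i₃, |α i₁ i₂ i₃ (0, 0, 1)| ≤ 1 := fun i₁ i₂ i₃ =>
    (hα.2.2 i₁ i₂ i₃ (0, 0, 1) (by rw [mem_shiftSet_iff]; simp)).1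
  -- reduced exponent `η₀ ≤ 1`, number of passes `J`, final exponent `aJ > 1`
  set η₀ : ℝ := min η 1 with hη₀
  have hη₀pos : 0 < η₀ := lt_min hη one_pos
  have hη₀1 : η₀ ≤ 1 := min_le_right _ _
  have hη₀η : η₀ ≤ η := min_le_left _ _
  set J : ℕ := ⌊2 / η₀⌋₊ + 1 with hJ
  set aJ : ℝ := (J : ℝ) * (η₀ / 2) with haJ
  have haJ1 : 1 < aJ := by
    have hfl : 2 / η₀ < (J : ℝ) := by
      simp only [hJ]
      push_cast
      exact Nat.lt_floor_add_one _
    have : 2 / η₀ * (η₀ / 2) = 1 := by field_simp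
    simp only [haJ]
    nlinarith [hfl, hη₀pos]
  have hJpred : ((J : ℝ) - 1) * (η₀ / 2) ≤ 1 := by
    have hfl : ((⌊2 / η₀⌋₊ : ℕ) : ℝ) ≤ 2 / η₀ := Nat.floor_le (by positivity)
    have hJ' : (J : ℝ) - 1 = ((⌊2 / η₀⌋₊ : ℕ) : ℝ) := by simp only [hJ]; push_cast; ring
    rw [hJ']
    calc ((⌊2 / η₀⌋₊ : ℕ) : ℝ) * (η₀ / 2) ≤ 2 / η₀ * (η₀ / 2) :=
          mul_le_mul_of_nonneg_right hfl (by positivity)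
      _ = 1 := by field_simp
  set η' : ℝ := aJ - 1 with hη'
  have hη'pos : 0 < η' := by simp only [hη']; linarith
  -- the geometric ratio of the final envelope
  set r : ℝ := (1 + ε₀) ^ (-aJ) with hr
  have hr0 : 0 ≤ r := Real.rpow_nonneg h0.le _
  have hr1 : r < 1 := Real.rpow_lt_one_of_one_lt_of_neg h1 (by linarith)
  refine exists_viscousGlobal_of_subcriticalEnvelope_of_inTableClass hε₀.le hη'pos hν hα X₀
    (fun T hT => ?_)
  obtain ⟨C, hC⟩ := henvS T hT
  set Cp : ℝ := max C 0 with hCp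
  have hCp0 : 0 ≤ Cp := le_max_right _ _
  set E₀ : ℝ := ∑ i : Fin 4, (1 / 2 : ℝ) * X₀ i ^ 2 with hE₀
  have hE₀0 : 0 ≤ E₀ := Finset.sum_nonneg fun i _ => by positivity
  -- a uniform majorant of the pass constants: `K_j ≤ E₁ Qf^j`
  set E₁ : ℝ := max E₀ 1 with hE₁
  set Qf : ℝ := max (128 * Real.sqrt (2 * Cp) / ν) 1 with hQf
  have hE₁0 : 0 ≤ E₁ := le_trans zero_le_one (le_max_right _ _)
  have hQf1 : 1 ≤ Qf := le_max_right _ _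
  have hQf0 : 0 ≤ Qf := zero_le_one.trans hQf1
  refine ⟨E₁ * Qf ^ J / (1 - r), fun s hs X hinit hlow hbd hcont hder n N hnN t ht => ?_⟩
  obtain ⟨M, hM⟩ := hbd
  -- the `S`-envelope for this solution, single shells, constant `Cp`, exponent `η₀`
  have hSenv : ∀ (k : ℕ), ∀ u ∈ Icc (0 : ℝ) s,
      ∑ i ∈ S, (1 / 2 : ℝ) * X i (k : ℤ) u ^ 2 ≤ Cp * (1 + ε₀) ^ (-((1 + η₀) * (k : ℝ))) := by
    intro k u hu
    have h := hC s hs X hinit hlow ⟨M, hM⟩ hcont hder k k le_rfl u hu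
    rw [Finset.Icc_self, Finset.sum_singleton] at h
    have hpow1 : (1 + ε₀) ^ (-((1 + η) * (k : ℝ))) ≤ (1 + ε₀) ^ (-((1 + η₀) * (k : ℝ))) :=
      Real.rpow_le_rpow_of_exponent_le h1.le
        (by nlinarith [hη₀η, (Nat.cast_nonneg k : (0 : ℝ) ≤ k)])
    calc ∑ i ∈ S, (1 / 2 : ℝ) * X i (k : ℤ) u ^ 2 ≤ C * (1 + ε₀) ^ (-((1 + η) * (k : ℝ))) := h
      _ ≤ Cp * (1 + ε₀) ^ (-((1 + η) * (k : ℝ))) :=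
          mul_le_mul_of_nonneg_right (le_max_left _ _) (Real.rpow_nonneg h0.le _)
      _ ≤ Cp * (1 + ε₀) ^ (-((1 + η₀) * (k : ℝ))) := mul_le_mul_of_nonneg_left hpow1 hCp0
  -- the passes
  have hiter : ∀ j : ℕ, j ≤ J → ∀ (k : ℕ), ∀ u ∈ Icc (0 : ℝ) s,
      ∑ i : Fin 4, (1 / 2 : ℝ) * X i (k : ℤ) u ^ 2 ≤
        E₁ * Qf ^ j * (1 + ε₀) ^ (-(((j : ℝ) * (η₀ / 2)) * (k : ℝ))) := by
    intro j
    induction j with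
    | zero =>
      intro _ k u hu
      have hsum : Summable fun j : ℕ => ∑ i : Fin 4, (1 / 2 : ℝ) * X i (j : ℤ) u ^ 2 :=
        (orthantBreak_summable hε₀ hM 0 u).congr fun j => by simp
      have hle1 : ∑ i : Fin 4, (1 / 2 : ℝ) * X i (k : ℤ) u ^ 2 ≤
          ∑' j : ℕ, ∑ i : Fin 4, (1 / 2 : ℝ) * X i (j : ℤ) u ^ 2 :=
        hsum.le_tsum k fun j _ => Finset.sum_nonneg fun i _ => by positivity
      have hle2 := orthantBreak_energy_le hε₀ hν hc hinit hlow hM hder hu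
      calc ∑ i : Fin 4, (1 / 2 : ℝ) * X i (k : ℤ) u ^ 2 ≤ E₀ := hle1.trans hle2
        _ ≤ E₁ := le_max_left _ _
        _ = E₁ * Qf ^ 0 * (1 + ε₀) ^ (-((((0 : ℕ) : ℝ) * (η₀ / 2)) * (k : ℝ))) := by
            simp
    | succ j ih =>
      intro hj k u hu
      have hjJ : j ≤ J := Nat.le_of_succ_le hj
      have haj0 : 0 ≤ (j : ℝ) * (η₀ / 2) := by positivity
      have haj1 : (j : ℝ) * (η₀ / 2) ≤ 1 := by
        have hjr : (j : ℝ) ≤ (J : ℝ) - 1 := by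
          have : ((j + 1 : ℕ) : ℝ) ≤ J := by exact_mod_cast hj
          push_cast at this
          linarith
        calc (j : ℝ) * (η₀ / 2) ≤ ((J : ℝ) - 1) * (η₀ / 2) :=
              mul_le_mul_of_nonneg_right hjr (by positivity)
          _ ≤ 1 := hJpred
      have hKj0 : 0 ≤ E₁ * Qf ^ j := by positivity
      have hpass := forwardSmoothing_pass hε₀ hν hη₀1 hCp0 hKj0 haj0 haj1 hc hα1 hS hinit
        hlow hM hder hSenv (ih hjJ) k hu
      -- `max E₀ (128 √(2Cp) K_j / ν) ≤ E₁ Qf^(j+1)`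
      have hconst : max E₀ (128 * Real.sqrt (2 * Cp) * (E₁ * Qf ^ j) / ν) ≤ E₁ * Qf ^ (j + 1) := by
        refine max_le ?_ ?_
        · calc E₀ ≤ E₁ := le_max_left _ _
            _ = E₁ * 1 := (mul_one _).symm
            _ ≤ E₁ * Qf ^ (j + 1) := mul_le_mul_of_nonneg_left (one_le_pow₀ hQf1) hE₁0
        · have hq : 128 * Real.sqrt (2 * Cp) / ν ≤ Qf := le_max_left _ _
          calc 128 * Real.sqrt (2 * Cp) * (E₁ * Qf ^ j) / ν
              = (128 * Real.sqrt (2 * Cp) / ν) * (E₁ * Qf ^ j) := by ring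
            _ ≤ Qf * (E₁ * Qf ^ j) := mul_le_mul_of_nonneg_right hq hKj0
            _ = E₁ * Qf ^ (j + 1) := by ring
      have hexp : -(((j : ℝ) * (η₀ / 2) + η₀ / 2) * (k : ℝ)) =
          -((((j + 1 : ℕ) : ℝ) * (η₀ / 2)) * (k : ℝ)) := by
        push_cast
        ring
      calc ∑ i : Fin 4, (1 / 2 : ℝ) * X i (k : ℤ) u ^ 2
          ≤ max E₀ (128 * Real.sqrt (2 * Cp) * (E₁ * Qf ^ j) / ν) *
              (1 + ε₀) ^ (-(((j : ℝ) * (η₀ / 2) + η₀ / 2) * (k : ℝ))) := hpass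
        _ ≤ E₁ * Qf ^ (j + 1) * (1 + ε₀) ^ (-(((j : ℝ) * (η₀ / 2) + η₀ / 2) * (k : ℝ))) :=
            mul_le_mul_of_nonneg_right hconst (Real.rpow_nonneg h0.le _)
        _ = E₁ * Qf ^ (j + 1) * (1 + ε₀) ^ (-((((j + 1 : ℕ) : ℝ) * (η₀ / 2)) * (k : ℝ))) := by
            rw [hexp]
  -- the final all-mode envelope, summed over the block `[n, N]`
  have hfinal := hiter J le_rfl
  have hshell : ∀ k : ℕ, ∑ i : Fin 4, (1 / 2 : ℝ) * X i (k : ℤ) t ^ 2 ≤ E₁ * Qf ^ J * r ^ k := by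
    intro k
    have h := hfinal k t ht
    have hrk : (1 + ε₀) ^ (-(((J : ℝ) * (η₀ / 2)) * (k : ℝ))) = r ^ k := by
      rw [hr, ← Real.rpow_natCast, ← Real.rpow_mul h0.le]
      congr 1
      simp only [haJ]
      ring
    rw [hrk] at h
    exact h
  have hgeom : ∑ k ∈ Finset.Icc n N, r ^ k ≤ r ^ n / (1 - r) := by
    have hI : Finset.Icc n N = Finset.Ico n (N + 1) := by
      ext k
      simp only [Finset.mem_Icc, Finset.mem_Ico]
      omega
    rw [hI]
    exact geom_sum_Ico_le_of_lt_one hr0 hr1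
  have hrn : r ^ n = (1 + ε₀) ^ (-((1 + η') * (n : ℝ))) := by
    rw [hr, ← Real.rpow_natCast, ← Real.rpow_mul h0.le]
    congr 1
    simp only [hη']
    ring
  have hKJ0 : 0 ≤ E₁ * Qf ^ J := by positivity
  calc ∑ k ∈ Finset.Icc n N, ∑ i : Fin 4, (1 / 2) * X i (k : ℤ) t ^ 2
      ≤ ∑ k ∈ Finset.Icc n N, E₁ * Qf ^ J * r ^ k := Finset.sum_le_sum fun k _ => hshell k
    _ = E₁ * Qf ^ J * ∑ k ∈ Finset.Icc n N, r ^ k := by rw [Finset.mul_sum]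
    _ ≤ E₁ * Qf ^ J * (r ^ n / (1 - r)) := mul_le_mul_of_nonneg_left hgeom hKJ0
    _ = E₁ * Qf ^ J / (1 - r) * (1 + ε₀) ^ (-((1 + η') * (n : ℝ))) := by
        rw [hrn]
        ring

end Summit.NavierStokesRegularity.NavierStokesRegularity.Theorems

end
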